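/-
Origin: expansion seat `planner-pub-hodgecm-mc-axioms-1-g14-0`, handover #W108 2026-08-20T15:53:55Z md5 98d9b99d6202 (PKG 59330119e547 → 98d9b99d6202; 230 l.; MECHANICAL (iib-R) rewrite v3.1 of the PKG file as it stands (89 token edits; rules R1x1+RX[h₂]x88)) (`HOME/mc/pub-hodgecm-mc-axioms-1-g14/revendor/kit-r55/stage55/HodgeCM/Model/E2Instance.lean`, md5 98d9b99d6202, 230 lines);
landed by the gen-22 packager (p-g22) in gate run 55 REPLACES the earlier landed copy of `HodgeCM/Model/E2Instance.lean` (seat copy carried the packager Origin header of an earlier run (stripped)).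
-/
/-
Origin: speedrun cell pub-hodgecm, MODEL-CONSTRUCTION sub-cell, unit pub-hodgecm-mc-glue-1-g2 (CONSTRUCTION PROVER,
gen 2 of mc-glue-1; node E = the ASSEMBLER, carver vacancy (iii), claimed 2026-08-18T20:50:11Z), seat
planner-pub-hodgecm-mc-glue-1-g2-0, 2026-08-18.
Target in PKG: `HodgeCM/Model/E2Instance.lean` (NEW additive leaf; imports the G0-d universe `HodgeCM.Model.Universe`
(mc-axioms-3 kit #220), the ₁₀ end state `HodgeCM.Model.EndStateMeet` (prl1-g11 kit #5) and the function-level bridge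
headline `HodgeCM.Model.Binders.MeetBridges` (mc-binder-1-g2 kit #1); nothing imports it).

WHAT THIS FILE IS.  The ONE term of MODEL-DAG §0: `Assembly.perL_ofSignRecipe₁₀ U M h C d12 d34 hS A hHR` at the
CONSTRUCTED universe `U := picardCMUniverse hHD hI h₁ h₃`, with `M := Model.modelAxiomsPerL …` (KERNEL, G0-d) and
`hHR := Model.hodgeRiemann20 … hHR` (over the row R-HR20).  Every remaining model-side input is a BY-NAME BINDER of the
exact PKG field type — DATA binders (`h`, the four fields `emb`/`cover`/`wm`/`Theta` of `C : U.AdelicThetaCore₀`, the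
side data `d12 d34`) and PROPERTY binders (the six inputs C2 `innerEmb`, C3 `thetaSub`, C4 `thetaWedge`, C5′ `gen12`,
C6′ `real34`, C7 `occ` of `AllCharsNonDesignPt₂` on the sextic class) — to be RETIRED one by one, in later revisions of
this file, by the producers' handed terms (vacancy (ii) `emb` instance: mc-axioms-3-g2; `wm`: J3 chain W5/J-W2glob via
`Junction/ThetaKernelDatumToPkg` + `Junction/WeilThetaModelComap`; `Theta`/C3: W6b + D3-geom; `d12 d34`: W6b-3
mc-period-2-g2; C4: W7a-inst mc-theta-3-g2; C5′/C6′: mc-binder-1-g2 `MeetBridges(Shells)`; C7: W8t; C2: D1-aut N-D2 +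
vacancy (ii)).  ABSOLUTE RULE honoured: nothing is asserted — a binder is a hypothesis node for MODEL-N (axioms-2), never
a cited fact; PerL / QW8 / the 2001 programme are not sources.  0 proof holes, 0 new axioms; `#print axioms` of every
theorem here ⊆ {propext, Classical.choice, Quot.sound} (scratch check, not handed).
-/
import Summits.HodgeConjecture.HodgeCM.Model.Universe
import Summits.HodgeConjecture.HodgeCM.Model.EndStateMeet_2
import Summits.HodgeConjecture.HodgeCM.Model.Binders.MeetBridges
import Summits.HodgeConjecture.HodgeCM.Automorphic.ThetaWedgeSplit

/-!
# E2 instance — `PerL` for the Picard–CM model universe, over named binders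

* `Model.perL_picardCM₀`  — stage 0: the core `C : U.AdelicThetaCore₀` and the record `A : AllCharsNonDesignPt₂ S` whole.
* `Model.perL_picardCM`   — stage 1: `C` assembled from its four DATA fields, `A` from the SIX inputs in the
  function-level-bridge form (`AllCharsNonDesignPt₂.ofFunBridges`, mc-binder-1-g2), on the sextic class
  `S c := (Module.finrank ℚ c.K = 6)` itself (the weakest admissible class: `hS := fun _ h ↦ h`).
-/

noncomputable section

open scoped TensorProduct InnerProductSpace

namespace HodgeCM

namespace Model

open HodgeCM.Universe (AdelicThetaCore AdelicThetaCore₀ SideData ThetaModel ModelAxiomsPerL)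
open Literature.AlgebraicGeometry.HodgeTheory
open Literature.NumberTheory.Automorphic.PicardCM

variable (hHD : exists_isReal_hodgeModel) (hI : hodgePQ_independent_of_hodgeModel)
  (h₁ : BallQuotientUniformised)  (h₃ : CMAbelianVarietyRealised)

/-- **E2 instance, stage 0.**  `PerL` for `picardCMUniverse hHD hI h₁ h₃` from: PerL's convention bit `h`; the
core DATA `C` (degree-two classes as `L²` functions, coverings, Weil theta models, theta one-forms) over the model
universe; the torus-side data `d12 d34`; the six-input meeting record `A` on a class `S ⊇ sextic`; and the row
`hHR : BettiUniverse.HodgeRiemann20`.  The model facts `M` are the KERNEL theorem `Model.modelAxiomsPerL`. -/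
theorem perL_picardCM₀ (hHR : BettiUniverse.HodgeRiemann20) (h : Bool)
    (C : (picardCMUniverse hHD hI h₁ h₃).AdelicThetaCore₀)
    (d12 d34 : ∀ {L : CMField}, SeesawCtx L → SideData L) {S : ∀ {L : CMField}, SeesawCtx L → Prop}
    (hS : ∀ {L : CMField} (c : SeesawCtx L), Module.finrank ℚ c.K = 6 → S c)
    (A : (C.thetaModel h d12 d34).AllCharsNonDesignPt₂ S) :
    (picardCMUniverse hHD hI h₁ h₃).PerL :=
  Assembly.perL_ofSignRecipe₁₀ _ (Model.modelAxiomsPerL hHD hI h₃ h₁) h C d12 d34 hS A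
    (Model.hodgeRiemann20 hHD hI h₃ h₁ hHR)

/-- The core DATA record assembled from its four fields (a definitional repackaging; no content). -/
abbrev coreOf (U : Universe)
    (emb : ∀ {L : CMField} {ι₁ : L →+* ℂ} {V : HermSpace3 L ι₁} (Γ : Level V),
      U.CohC (U.pms L ι₁ V Γ) 2 →ₗ[ℂ] (V.latticeModel printFact_unitaryCompact_holds).toQuotientModel.H)
    (cover : ∀ {L : CMField} {ι₁ : L →+* ℂ} {V : HermSpace3 L ι₁} (Γ Γ' : Level V),
      Γ'.Γ ≤ Γ.Γ → U.Mor (U.pms L ι₁ V Γ') (U.pms L ι₁ V Γ))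
    (wm : ∀ {L : CMField} {ι₁ : L →+* ℂ} (V : HermSpace3 L ι₁) (c : SeesawCtx L),
      WeilThetaModel (V.latticeModel printFact_unitaryCompact_holds).toQuotientModel.G
        (V.latticeModel printFact_unitaryCompact_holds).toQuotientModel.Γ
        (c.D.latticeModelW printFact_unitaryCompact_holds).toQuotientModel.G
        (c.D.latticeModelW printFact_unitaryCompact_holds).toQuotientModel.Γ)
    (Theta : ∀ {L : CMField} {ι₁ : L →+* ℂ} (V : HermSpace3 L ι₁), SeesawCtx L → Fin 4 → ∀ Γ : Level V,
      Set (U.CohC (U.pms L ι₁ V Γ) 1)) :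
    U.AdelicThetaCore₀ :=
  ⟨emb, cover, wm, Theta⟩

/-- The END STATE's theta model over the model universe, from the four DATA fields of the core, PerL's bit and the
side data (a `reducible` name for `(coreOf U emb cover wm Theta).thetaModel h d12 d34`; no content). -/
abbrev thetaModelOf (h : Bool)
    (emb : ∀ {L : CMField} {ι₁ : L →+* ℂ} {V : HermSpace3 L ι₁} (Γ : Level V),
      (picardCMUniverse hHD hI h₁ h₃).CohC ((picardCMUniverse hHD hI h₁ h₃).pms L ι₁ V Γ) 2 →ₗ[ℂ]
        (V.latticeModel printFact_unitaryCompact_holds).toQuotientModel.H)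
    (cover : ∀ {L : CMField} {ι₁ : L →+* ℂ} {V : HermSpace3 L ι₁} (Γ Γ' : Level V),
      Γ'.Γ ≤ Γ.Γ → (picardCMUniverse hHD hI h₁ h₃).Mor ((picardCMUniverse hHD hI h₁ h₃).pms L ι₁ V Γ')
        ((picardCMUniverse hHD hI h₁ h₃).pms L ι₁ V Γ))
    (wm : ∀ {L : CMField} {ι₁ : L →+* ℂ} (V : HermSpace3 L ι₁) (c : SeesawCtx L),
      WeilThetaModel (V.latticeModel printFact_unitaryCompact_holds).toQuotientModel.G
        (V.latticeModel printFact_unitaryCompact_holds).toQuotientModel.Γ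
        (c.D.latticeModelW printFact_unitaryCompact_holds).toQuotientModel.G
        (c.D.latticeModelW printFact_unitaryCompact_holds).toQuotientModel.Γ)
    (Theta : ∀ {L : CMField} {ι₁ : L →+* ℂ} (V : HermSpace3 L ι₁), SeesawCtx L → Fin 4 → ∀ Γ : Level V,
      Set ((picardCMUniverse hHD hI h₁ h₃).CohC ((picardCMUniverse hHD hI h₁ h₃).pms L ι₁ V Γ) 1))
    (d12 d34 : ∀ {L : CMField}, SeesawCtx L → SideData L) : (picardCMUniverse hHD hI h₁ h₃).ThetaModel :=
  (coreOf _ emb cover wm Theta).thetaModel h d12 d34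

/-- **E2 instance, stage 1 (the term of record over named binders).**  `PerL` for the model universe from the four
DATA fields of the core, the side data, and the SIX property inputs C2 C3 C4 C5′ C6′ C7 — C5′/C6′ in the function-level
bridge form of mc-binder-1-g2 — each demanded only at GOOD SEXTIC contexts (`Module.finrank ℚ c.K = 6`), stated over
`T := thetaModelOf hHD hI h₁ h₃ h emb cover wm Theta d12 d34` exactly as the fields of `AllCharsNonDesignPt₂` /
the binders of `Assembly.perL_ofFunBridges₁₀` read. -/
theorem perL_picardCM (hHR : BettiUniverse.HodgeRiemann20) (h : Bool)
    (emb : ∀ {L : CMField} {ι₁ : L →+* ℂ} {V : HermSpace3 L ι₁} (Γ : Level V),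
      (picardCMUniverse hHD hI h₁ h₃).CohC ((picardCMUniverse hHD hI h₁ h₃).pms L ι₁ V Γ) 2 →ₗ[ℂ]
        (V.latticeModel printFact_unitaryCompact_holds).toQuotientModel.H)
    (cover : ∀ {L : CMField} {ι₁ : L →+* ℂ} {V : HermSpace3 L ι₁} (Γ Γ' : Level V),
      Γ'.Γ ≤ Γ.Γ → (picardCMUniverse hHD hI h₁ h₃).Mor ((picardCMUniverse hHD hI h₁ h₃).pms L ι₁ V Γ')
        ((picardCMUniverse hHD hI h₁ h₃).pms L ι₁ V Γ))
    (wm : ∀ {L : CMField} {ι₁ : L →+* ℂ} (V : HermSpace3 L ι₁) (c : SeesawCtx L),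
      WeilThetaModel (V.latticeModel printFact_unitaryCompact_holds).toQuotientModel.G
        (V.latticeModel printFact_unitaryCompact_holds).toQuotientModel.Γ
        (c.D.latticeModelW printFact_unitaryCompact_holds).toQuotientModel.G
        (c.D.latticeModelW printFact_unitaryCompact_holds).toQuotientModel.Γ)
    (Theta : ∀ {L : CMField} {ι₁ : L →+* ℂ} (V : HermSpace3 L ι₁), SeesawCtx L → Fin 4 → ∀ Γ : Level V,
      Set ((picardCMUniverse hHD hI h₁ h₃).CohC ((picardCMUniverse hHD hI h₁ h₃).pms L ι₁ V Γ) 1))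
    (d12 d34 : ∀ {L : CMField}, SeesawCtx L → SideData L)
    (innerEmb : ∀ {L : CMField} {ι₁ : L →+* ℂ} (V : HermSpace3 L ι₁) (c : SeesawCtx L),
      (thetaModelOf hHD hI h₁ h₃ h emb cover wm Theta d12 d34).GoodCtx ι₁ c → Module.finrank ℚ c.K = 6 →
      (thetaModelOf hHD hI h₁ h₃ h emb cover wm Theta d12 d34).InnerEmbAt V)
    (thetaSub : ∀ {L : CMField} {ι₁ : L →+* ℂ} (V : HermSpace3 L ι₁) (c : SeesawCtx L),
      (thetaModelOf hHD hI h₁ h₃ h emb cover wm Theta d12 d34).GoodCtx ι₁ c → Module.finrank ℚ c.K = 6 →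
      ∀ (i : Fin 4) (Γ : Level V), (thetaModelOf hHD hI h₁ h₃ h emb cover wm Theta d12 d34).Theta V c i Γ ⊆
        (picardCMUniverse hHD hI h₁ h₃).Uiso Γ c.K (c.Ψ i) c.σ)
    (thetaWedge : ∀ {L : CMField} {ι₁ : L →+* ℂ} (V : HermSpace3 L ι₁) (c : SeesawCtx L),
      (thetaModelOf hHD hI h₁ h₃ h emb cover wm Theta d12 d34).GoodCtx ι₁ c → Module.finrank ℚ c.K = 6 →
      ∃ Γ : Level V, ∃ ω₁ ∈ (thetaModelOf hHD hI h₁ h₃ h emb cover wm Theta d12 d34).Theta V c 0 Γ,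
        ∃ ω₂ ∈ (thetaModelOf hHD hI h₁ h₃ h emb cover wm Theta d12 d34).Theta V c 1 Γ,
        (picardCMUniverse hHD hI h₁ h₃).cup2C ((picardCMUniverse hHD hI h₁ h₃).pms L ι₁ V Γ) 1 ω₁ ω₂ ≠ 0)
    (gen12 : ∀ {L : CMField} {ι₁ : L →+* ℂ} (V : HermSpace3 L ι₁) (c : SeesawCtx L),
      (thetaModelOf hHD hI h₁ h₃ h emb cover wm Theta d12 d34).GoodCtx ι₁ c → Module.finrank ℚ c.K = 6 →
      Nonempty ((thetaModelOf hHD hI h₁ h₃ h emb cover wm Theta d12 d34).Gen12FunBridge V c))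
    (real34 : ∀ {L : CMField} {ι₁ : L →+* ℂ} (V : HermSpace3 L ι₁) (c : SeesawCtx L),
      (thetaModelOf hHD hI h₁ h₃ h emb cover wm Theta d12 d34).GoodCtx ι₁ c → Module.finrank ℚ c.K = 6 →
      Nonempty ((thetaModelOf hHD hI h₁ h₃ h emb cover wm Theta d12 d34).Real34FunBridge V c))
    (occ : ∀ {L : CMField} {ι₁ : L →+* ℂ} (V : HermSpace3 L ι₁) (c : SeesawCtx L),
      (thetaModelOf hHD hI h₁ h₃ h emb cover wm Theta d12 d34).GoodCtx ι₁ c → Module.finrank ℚ c.K = 6 →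
      (∀ (Φ : (thetaModelOf hHD hI h₁ h₃ h emb cover wm Theta d12 d34).SK V c)
          (i : (thetaModelOf hHD hI h₁ h₃ h emb cover wm Theta d12 d34).SigIdx V c),
          (∃ v ∈ ((thetaModelOf hHD hI h₁ h₃ h emb cover wm Theta d12 d34).core V c).hatσ i,
              ((thetaModelOf hHD hI h₁ h₃ h emb cover wm Theta d12 d34).core V c).TΦ Φ v ≠ 0) →
          ((thetaModelOf hHD hI h₁ h₃ h emb cover wm Theta d12 d34).t12 V c).wOccurs i) ∧
        (∀ (Φ : (thetaModelOf hHD hI h₁ h₃ h emb cover wm Theta d12 d34).SK V c)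
          (i : (thetaModelOf hHD hI h₁ h₃ h emb cover wm Theta d12 d34).SigIdx V c),
          (∃ v ∈ ((thetaModelOf hHD hI h₁ h₃ h emb cover wm Theta d12 d34).core V c).hatσ i,
              ((thetaModelOf hHD hI h₁ h₃ h emb cover wm Theta d12 d34).core V c).TΦ Φ v ≠ 0) →
          ((thetaModelOf hHD hI h₁ h₃ h emb cover wm Theta d12 d34).t34 V c).wOccurs i)) :
    (picardCMUniverse hHD hI h₁ h₃).PerL :=
  Assembly.perL_ofFunBridges₁₀ _ (Model.modelAxiomsPerL hHD hI h₃ h₁) h (coreOf _ emb cover wm Theta) d12 d34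
    (S := fun c => Module.finrank ℚ c.K = 6) (fun _ hK => hK) innerEmb thetaSub thetaWedge gen12 real34 occ
    (Model.hodgeRiemann20 hHD hI h₃ h₁ hHR)

/-- **E2 instance, stage 2a (C4 through the package's uniformisation route).**  As `perL_picardCM`, with the C4
binder `thetaWedge` DISCHARGED IN KERNEL by `ThetaModel.exists_cup_ne_zero_of_ballFacts` (PerL Prop 4.3 proved in
`ThetaWedgeSplit` from the uniformisation layer) from THREE finer inputs at good sextic contexts, typed by the package's
own records: the uniformisation DATA `ball V c : U.BallData V c` (MODEL-DAG D1-G-i/ii, autform-1 lineage), its FACTS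
`ballFacts : T.BallFacts V c (ball V c)` (D1-G-iii: PRINT `trans/dense/wedgeDict`, OPEN INPUT `transl` = N33b,
INTERFACE `ev/contEv/evNe/saturate`), and the SUPPLY pair `supply` (= `Open_supply` at the context: a nonzero theta
one-form of each of the types `Ψ₀, Ψ₁` at some level; W7a-inst theta-3-g2 `open_supply_of_pairSupplyData` /
`PairSupplyData T V c 0/1`).  Nothing asserted; the other binders are unchanged. -/
theorem perL_picardCM_ball (hHR : BettiUniverse.HodgeRiemann20) (h : Bool)
    (emb : ∀ {L : CMField} {ι₁ : L →+* ℂ} {V : HermSpace3 L ι₁} (Γ : Level V),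
      (picardCMUniverse hHD hI h₁ h₃).CohC ((picardCMUniverse hHD hI h₁ h₃).pms L ι₁ V Γ) 2 →ₗ[ℂ]
        (V.latticeModel printFact_unitaryCompact_holds).toQuotientModel.H)
    (cover : ∀ {L : CMField} {ι₁ : L →+* ℂ} {V : HermSpace3 L ι₁} (Γ Γ' : Level V),
      Γ'.Γ ≤ Γ.Γ → (picardCMUniverse hHD hI h₁ h₃).Mor ((picardCMUniverse hHD hI h₁ h₃).pms L ι₁ V Γ')
        ((picardCMUniverse hHD hI h₁ h₃).pms L ι₁ V Γ))
    (wm : ∀ {L : CMField} {ι₁ : L →+* ℂ} (V : HermSpace3 L ι₁) (c : SeesawCtx L),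
      WeilThetaModel (V.latticeModel printFact_unitaryCompact_holds).toQuotientModel.G
        (V.latticeModel printFact_unitaryCompact_holds).toQuotientModel.Γ
        (c.D.latticeModelW printFact_unitaryCompact_holds).toQuotientModel.G
        (c.D.latticeModelW printFact_unitaryCompact_holds).toQuotientModel.Γ)
    (Theta : ∀ {L : CMField} {ι₁ : L →+* ℂ} (V : HermSpace3 L ι₁), SeesawCtx L → Fin 4 → ∀ Γ : Level V,
      Set ((picardCMUniverse hHD hI h₁ h₃).CohC ((picardCMUniverse hHD hI h₁ h₃).pms L ι₁ V Γ) 1))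
    (d12 d34 : ∀ {L : CMField}, SeesawCtx L → SideData L)
    (innerEmb : ∀ {L : CMField} {ι₁ : L →+* ℂ} (V : HermSpace3 L ι₁) (c : SeesawCtx L),
      (thetaModelOf hHD hI h₁ h₃ h emb cover wm Theta d12 d34).GoodCtx ι₁ c → Module.finrank ℚ c.K = 6 →
      (thetaModelOf hHD hI h₁ h₃ h emb cover wm Theta d12 d34).InnerEmbAt V)
    (thetaSub : ∀ {L : CMField} {ι₁ : L →+* ℂ} (V : HermSpace3 L ι₁) (c : SeesawCtx L),
      (thetaModelOf hHD hI h₁ h₃ h emb cover wm Theta d12 d34).GoodCtx ι₁ c → Module.finrank ℚ c.K = 6 →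
      ∀ (i : Fin 4) (Γ : Level V), (thetaModelOf hHD hI h₁ h₃ h emb cover wm Theta d12 d34).Theta V c i Γ ⊆
        (picardCMUniverse hHD hI h₁ h₃).Uiso Γ c.K (c.Ψ i) c.σ)
    (ball : ∀ {L : CMField} {ι₁ : L →+* ℂ} (V : HermSpace3 L ι₁) (c : SeesawCtx L),
      (picardCMUniverse hHD hI h₁ h₃).BallData V c)
    (ballFacts : ∀ {L : CMField} {ι₁ : L →+* ℂ} (V : HermSpace3 L ι₁) (c : SeesawCtx L),
      (thetaModelOf hHD hI h₁ h₃ h emb cover wm Theta d12 d34).GoodCtx ι₁ c → Module.finrank ℚ c.K = 6 →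
      (thetaModelOf hHD hI h₁ h₃ h emb cover wm Theta d12 d34).BallFacts V c (ball V c))
    (supply : ∀ {L : CMField} {ι₁ : L →+* ℂ} (V : HermSpace3 L ι₁) (c : SeesawCtx L),
      (thetaModelOf hHD hI h₁ h₃ h emb cover wm Theta d12 d34).GoodCtx ι₁ c → Module.finrank ℚ c.K = 6 →
      (∃ Γ : Level V, ∃ ω ∈ (thetaModelOf hHD hI h₁ h₃ h emb cover wm Theta d12 d34).Theta V c 0 Γ, ω ≠ 0) ∧
        (∃ Γ : Level V, ∃ ω ∈ (thetaModelOf hHD hI h₁ h₃ h emb cover wm Theta d12 d34).Theta V c 1 Γ, ω ≠ 0))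
    (gen12 : ∀ {L : CMField} {ι₁ : L →+* ℂ} (V : HermSpace3 L ι₁) (c : SeesawCtx L),
      (thetaModelOf hHD hI h₁ h₃ h emb cover wm Theta d12 d34).GoodCtx ι₁ c → Module.finrank ℚ c.K = 6 →
      Nonempty ((thetaModelOf hHD hI h₁ h₃ h emb cover wm Theta d12 d34).Gen12FunBridge V c))
    (real34 : ∀ {L : CMField} {ι₁ : L →+* ℂ} (V : HermSpace3 L ι₁) (c : SeesawCtx L),
      (thetaModelOf hHD hI h₁ h₃ h emb cover wm Theta d12 d34).GoodCtx ι₁ c → Module.finrank ℚ c.K = 6 →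
      Nonempty ((thetaModelOf hHD hI h₁ h₃ h emb cover wm Theta d12 d34).Real34FunBridge V c))
    (occ : ∀ {L : CMField} {ι₁ : L →+* ℂ} (V : HermSpace3 L ι₁) (c : SeesawCtx L),
      (thetaModelOf hHD hI h₁ h₃ h emb cover wm Theta d12 d34).GoodCtx ι₁ c → Module.finrank ℚ c.K = 6 →
      (∀ (Φ : (thetaModelOf hHD hI h₁ h₃ h emb cover wm Theta d12 d34).SK V c)
          (i : (thetaModelOf hHD hI h₁ h₃ h emb cover wm Theta d12 d34).SigIdx V c),
          (∃ v ∈ ((thetaModelOf hHD hI h₁ h₃ h emb cover wm Theta d12 d34).core V c).hatσ i,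
              ((thetaModelOf hHD hI h₁ h₃ h emb cover wm Theta d12 d34).core V c).TΦ Φ v ≠ 0) →
          ((thetaModelOf hHD hI h₁ h₃ h emb cover wm Theta d12 d34).t12 V c).wOccurs i) ∧
        (∀ (Φ : (thetaModelOf hHD hI h₁ h₃ h emb cover wm Theta d12 d34).SK V c)
          (i : (thetaModelOf hHD hI h₁ h₃ h emb cover wm Theta d12 d34).SigIdx V c),
          (∃ v ∈ ((thetaModelOf hHD hI h₁ h₃ h emb cover wm Theta d12 d34).core V c).hatσ i,
              ((thetaModelOf hHD hI h₁ h₃ h emb cover wm Theta d12 d34).core V c).TΦ Φ v ≠ 0) →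
          ((thetaModelOf hHD hI h₁ h₃ h emb cover wm Theta d12 d34).t34 V c).wOccurs i)) :
    (picardCMUniverse hHD hI h₁ h₃).PerL :=
  perL_picardCM hHD hI h₁ h₃ hHR h emb cover wm Theta d12 d34 innerEmb thetaSub
    (fun V c hc hK => (thetaModelOf hHD hI h₁ h₃ h emb cover wm Theta d12 d34).exists_cup_ne_zero_of_ballFacts
      V c (ball V c) (ballFacts V c hc hK) (supply V c hc hK))
    gen12 real34 occ

/-- Sanity (definitional): the theta one-forms, `κ` and frame sign of the END STATE's theta model ARE the binder
`Theta`, PerL's `SignRecipe.kappa h` and `SignRecipe.frameSign`. -/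
example (h : Bool) (emb) (cover) (wm) (Theta) (d12 d34 : ∀ {L : CMField}, SeesawCtx L → SideData L) :
    (thetaModelOf hHD hI h₁ h₃ h emb cover wm Theta d12 d34).kappa = HodgeCM.SignRecipe.kappa h ∧
      (thetaModelOf hHD hI h₁ h₃ h emb cover wm Theta d12 d34).frameSign = HodgeCM.SignRecipe.frameSign :=
  ⟨rfl, rfl⟩

end Model

end HodgeCM
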